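import Summits.RiemannHypothesis.RiemannHypothesis.Theorems.AsymptoticCriticalLine.Negative.Split
import Summits.RiemannHypothesis.RiemannHypothesis.Theorems.AsymptoticCriticalLine.Negative.Truncation
import Summits.RiemannHypothesis.RiemannHypothesis.Theorems.AsymptoticCriticalLine.Negative.Scaling
import Summits.RiemannHypothesis.RiemannHypothesis.Theorems.AsymptoticCriticalLine.Negative.BeurlingInterior

/-!
# Witnesses separating the two halves of `AsymptoticCriticalLine` (negative lemmas, cycle 3)

Corollaries joining `Split.lean` (the shapes `NoInteriorBandShape` / `EdgeZeroFreeShape` of card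
interior-edge-split) with the objects of `Truncation.lean`, `Scaling.lean`, `BeurlingInterior.lean`:
* UNCONDITIONAL separation: the truncation `ζ₃ = 1 + 2^{−s} + 3^{−s}` has the edge half TRUE and
  the interior half FALSE (`edge_zetaPartialSum_three`, `not_noInterior_zetaPartialSum_three`);
* the tempered two-band Euler product `Z₂ = ζ(s)ζ(2s)`, `ζ(2s)` and the Beurling-type rescaling
  `ζ(2s − 1)` (Broucke 2024 Thm 6.3) have the interior half FALSE and the edge half EXACTLY `ζ`'s
  (route Strip's crux): `not_noInterior_zetaTwoMul`, `not_noInterior_zetaZetaTwo`,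
  `edge_zetaZetaTwo_iff`, `not_noInterior_zetaRescaledHalf`, `edge_zetaRescaledHalf_iff`.
So the two halves are logically independent given present knowledge, and the interior half is
the one sensitive to every exactness input (local factors, width, iterate weights, truncation,
Beurling integrality `θ ≥ 1/2`).
-/

noncomputable section

namespace Summit.RiemannHypothesis.RiemannHypothesis.Theorems.AsymptoticCriticalLine.Negative

open Complex Set
open Literature.Barriers.RiemannHypothesis (zetaPartialSum)

/-- INTERIOR HALF FAILS for the truncation `ζ₃` (window radius `min ε (σ₃ − 1/2) (1 − σ₃)`). [folklore] -/
theorem not_noInterior_zetaPartialSum_three : ¬ NoInteriorBandShape (zetaPartialSum 3) := by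
  intro h
  obtain ⟨σ₃, hlo, hhi, hwin, -⟩ := zetaPartialSum_three_interior_band
  obtain ⟨ε, hε, hfin⟩ := h σ₃ (by linarith) hhi hlo.ne'
  set r : ℝ := min ε (min (σ₃ - 1 / 2) (1 - σ₃)) with hr
  have hr0 : 0 < r := lt_min hε (lt_min (by linarith) (by linarith))
  have hrε : r ≤ ε := min_le_left _ _
  have hr1 : r ≤ σ₃ - 1 / 2 := (min_le_right _ _).trans (min_le_left _ _)
  have hr2 : r ≤ 1 - σ₃ := (min_le_right _ _).trans (min_le_right _ _)
  refine hwin r hr0 (hfin.subset ?_)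
  rintro s ⟨hz, hw⟩
  obtain ⟨hw1, hw2⟩ := abs_sub_lt_iff.1 hw
  exact ⟨hz, by linarith, by linarith, abs_sub_lt_iff.2 ⟨by linarith, by linarith⟩⟩

/-- … while its EDGE HALF HOLDS, unconditionally: `ζ₃` separates the two halves of the crux with no
hypothesis on `ζ`. [folklore] -/
theorem edge_zetaPartialSum_three : EdgeZeroFreeShape (zetaPartialSum 3) := by
  obtain ⟨σ₃, _, hhi, -, hright⟩ := zetaPartialSum_three_interior_band
  exact ⟨1 - σ₃, by linarith, fun s hz hlo _ => by have := hright s hz; linarith⟩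

/-- The two halves are independent: an object with edge ∧ ¬interior exists outright. [folklore] -/
theorem exists_edge_and_not_noInterior :
    ∃ Z : ℂ → ℂ, EdgeZeroFreeShape Z ∧ ¬ NoInteriorBandShape Z :=
  ⟨zetaPartialSum 3, edge_zetaPartialSum_three, not_noInterior_zetaPartialSum_three⟩

/-- INTERIOR HALF FAILS for `ζ(2s)`: the line `Re s = 1/4` is populated (Hardy). [folklore] -/
theorem not_noInterior_zetaTwoMul : ¬ NoInteriorBandShape zetaTwoMul := by
  refine not_noInterior_of_line (σ₀ := 1 / 4) (by norm_num) (by norm_num) (by norm_num) ?_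
  have hH : {t : ℝ | riemannZeta (1 / 2 + t * I) = 0}.Infinite :=
    Literature.NumberTheory.LFunctions.hardy_infinite_zeros_on_critical_line_holds
  have hsub : (fun u : ℝ => u / 2) '' {t : ℝ | riemannZeta (1 / 2 + t * I) = 0}
      ⊆ {t : ℝ | zetaTwoMul (((1 / 4 : ℝ) : ℂ) + t * I) = 0} := by
    rintro _ ⟨u, hu, rfl⟩
    show zetaTwoMul (quarterPt u) = 0
    rwa [zetaTwoMul_quarterPt]
  have hinj : Set.InjOn (fun u : ℝ => u / 2) {t : ℝ | riemannZeta (1 / 2 + t * I) = 0} := by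
    intro a _ b _ hab
    have : a / 2 = b / 2 := hab
    linarith
  exact (hH.image hinj).mono hsub

/-- INTERIOR HALF FAILS for the tempered degree-3 Euler product `Z₂ = ζ(s)ζ(2s)`. [folklore] -/
theorem not_noInterior_zetaZetaTwo : ¬ NoInteriorBandShape zetaZetaTwo := by
  intro h
  refine not_noInterior_zetaTwoMul fun σ₀ h0 h1 hne => ?_
  obtain ⟨ε, hε, hfin⟩ := h σ₀ h0 h1 hne
  exact ⟨ε, hε, hfin.subset fun s ⟨hz, hs0, hs1, hw⟩ =>
    ⟨by rw [zetaZetaTwo, hz, mul_zero], hs0, hs1, hw⟩⟩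

/-- … while the EDGE HALF of `Z₂` is exactly `ζ`'s (`ζ(2s) ≠ 0` on `Re s ≥ 1/2`). [folklore] -/
theorem edge_zetaZetaTwo_iff : EdgeZeroFreeShape zetaZetaTwo ↔ EdgeZeroFreeShape riemannZeta := by
  constructor
  · rintro ⟨δ, hδ, h⟩
    exact ⟨δ, hδ, fun s hz hlo hhi => h s (by rw [zetaZetaTwo, hz, zero_mul]) hlo hhi⟩
  · rintro ⟨δ, hδ, h⟩
    refine ⟨min δ (1 / 2), lt_min hδ (by norm_num), fun s hz hlo hhi => ?_⟩
    have hs : 1 / 2 ≤ s.re := by linarith [min_le_right δ (1 / 2)]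
    exact h s ((zetaZetaTwo_eq_zero_iff hs).1 hz) (by linarith [min_le_left δ (1 / 2)]) hhi

/-- INTERIOR HALF FAILS in Beurling's world with `θ = 1/2` integers: `ζ(2s − 1)` (Broucke 2024
Thm 6.3). [cite: Broucke2024, Thm 6.3] -/
theorem not_noInterior_zetaRescaledHalf : ¬ NoInteriorBandShape zetaRescaledHalf := fun h => by
  obtain ⟨ε, hε, hfin⟩ := h (3 / 4) (by norm_num) (by norm_num) (by norm_num)
  exact windows_zetaRescaledHalf_infinite hε hfin

/-- … while its EDGE HALF is `ζ`'s, rescaled: route Strip's crux again. [folklore] -/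
theorem edge_zetaRescaledHalf_iff : EdgeZeroFreeShape zetaRescaledHalf ↔ EdgeZeroFreeShape riemannZeta := by
  constructor
  · rintro ⟨δ, hδ, h⟩
    refine ⟨δ / 2, by linarith, fun s hz hlo hhi => h ((s + 1) / 2) ?_ ?_ ?_⟩
    · rw [zetaRescaledHalf, show 2 * ((s + 1) / 2) - 1 = s by ring]; exact hz
    · have : ((s + 1) / 2).re = (s.re + 1) / 2 := by simp
      rw [this]; linarith
    · have : ((s + 1) / 2).re = (s.re + 1) / 2 := by simp
      rw [this]; linarith
  · rintro ⟨δ, hδ, h⟩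
    refine ⟨δ / 2, by linarith, fun s hz hlo hhi => h (2 * s - 1) hz ?_ ?_⟩
    · rw [re_two_mul_sub_one]; linarith
    · rw [re_two_mul_sub_one]; linarith

end Summit.RiemannHypothesis.RiemannHypothesis.Theorems.AsymptoticCriticalLine.Negative
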